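import Summits.Ventures.HSemireg.WedgeHankelRecurrenceGaussChebyshevHalfAngle

/-!
# Venture HSemireg — **GAUSS–CHEBYSHEV NODES AGAINST CHEBYSHEV EXTREMA: `Res_{(n, m)}(T_n, T_{m+1}′) = (m+1)^n · Res_{(n,m)}(T_n, U_m)`** in every commutative ring (`T_{m+1}′ = (m+1) U_m`), hence over
# `ℤ` the closed form `(m+1)^n · [0 or (−1)^{nm∕2} 2^{nm + gcd(n,m+1) − m − 1}]` from N464, and **`Res(T_n, T_{m+1}′) = 0 ⟺ (m+1) ∕ gcd(n, m+1)` is even** — a node of the `n`-point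
# Gauss–Chebyshev rule is an interior extremum of `T_{m+1}` (a Clenshaw–Curtis ∕ Gauss–Lobatto–Chebyshev interior node of order `m+1`) exactly in that case

HONEST FRAMING. Part of the Lean index of the computation cell `pub-hsemireg` (seat p10 gen 48, Sunday typer «UNIFORM-IN-n»).  Polynomial ∕ resultant algebra only; no variety, no cohomology theory,
no sheaf, no Ext group and no semiregularity map is constructed here; nothing here says that HC / HC_CM / HC_AV holds; no Literature fact (unproved `Prop`) is declared or used.  Custodian versions
as in `WedgeHankelSiegelIdeal` (1/3).
SOURCES (cited).  T. J. Rivlin, *Chebyshev Polynomials* (1990), §1.2 (extrema `cos(jπ∕n)` of `T_n`, `T_n′ = n U_{n−1}`); K. Dilcher, K. B. Stolarsky, Trans. Amer. Math. Soc. 357 (2005) 965–981, §3.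
PROOF TYPED HERE.  Mathlib `Polynomial.Chebyshev.T_derivative_eq_U`, `resultant_C_mul_right`; N464 `chebyshevTU_resultant_closed`; N463 `chebyshevTU_resultant_eq_zero_iff`.
DEDUP DISCLOSURE (`rg -n 'chebyshevT_resultant_derivative_T|resultant_derivative_T_eq_zero_iff' Summits Literature HarnessLib`, 2026-09-04): N407 uses `Res(T_n, T_n′)` (the discriminant, same index);
0 hits for the 3 names below.

WHAT IS IN THE TREE.  N407, N463, N464.
THIS FILE (namespace `Summit.Ventures.HSemireg.Wedge.HankelOuter` continued; CHAINED on N478; 0 definitions):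
* §1244 **`chebyshevT_resultant_derivative_T`** (any commutative ring), **`chebyshevT_resultant_derivative_T_closed`** (`ℤ`), **`chebyshevT_resultant_derivative_T_eq_zero_iff`** (`ℤ`).
CAVEATS.  Formal degrees `n`, `m` explicit (`deg T_{m+1}′ = m` over `ℤ`).  Nothing Ext-side.  New names only.
-/

open Module Polynomial
open scoped Matrix Polynomial

namespace Summit.Ventures.HSemireg.Wedge.HankelOuter

/-! ## §1244. `Res(T_n, T_{m+1}′)`: Gauss–Chebyshev nodes against the extrema of `T_{m+1}` -/

/-- **`Res_{(n,m)}(T_n, T_{m+1}′) = (m+1)^n · Res_{(n,m)}(T_n, U_m)`** in every commutative ring (`T_{m+1}′ = (m+1) U_m`). [Rivlin §1.2; this file, §1244] -/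
theorem chebyshevT_resultant_derivative_T (R : Type*) [CommRing R] (n m : ℕ) :
    (Polynomial.Chebyshev.T R (n : ℤ)).resultant (derivative (Polynomial.Chebyshev.T R ((m : ℤ) + 1))) n m =
      ((m : R) + 1) ^ n * (Polynomial.Chebyshev.T R (n : ℤ)).resultant (Polynomial.Chebyshev.U R (m : ℤ)) n m := by
  rw [Polynomial.Chebyshev.T_derivative_eq_U, add_sub_cancel_right, show (((m : ℤ) + 1 : ℤ) : R[X]) = Polynomial.C ((m : R) + 1) by simp, Polynomial.resultant_C_mul_right]

/-- **Over `ℤ`: `Res_{(n,m)}(T_n, T_{m+1}′) = 0` if `(m+1) ∕ gcd(n, m+1)` is even, `= (m+1)^n (−1)^{nm∕2} 2^{nm + gcd(n,m+1) − m − 1}` otherwise.** [via N464; this file, §1244] -/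
theorem chebyshevT_resultant_derivative_T_closed (n m : ℕ) :
    (Polynomial.Chebyshev.T ℤ (n : ℤ)).resultant (derivative (Polynomial.Chebyshev.T ℤ ((m : ℤ) + 1))) n m =
      if Even ((m + 1) / Nat.gcd n (m + 1)) then 0 else ((m : ℤ) + 1) ^ n * ((-1) ^ (n * m / 2) * 2 ^ (n * m + Nat.gcd n (m + 1) - m - 1)) := by
  rw [chebyshevT_resultant_derivative_T ℤ n m, chebyshevTU_resultant_closed]
  split_ifs <;> simp

/-- **A Gauss–Chebyshev node of order `n` is a critical point of `T_{m+1}` (resultant vanishes) iff `(m+1) ∕ gcd(n, m+1)` is even** (over `ℤ`). [this file, §1244] -/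
theorem chebyshevT_resultant_derivative_T_eq_zero_iff (n m : ℕ) :
    (Polynomial.Chebyshev.T ℤ (n : ℤ)).resultant (derivative (Polynomial.Chebyshev.T ℤ ((m : ℤ) + 1))) n m = 0 ↔ Even ((m + 1) / Nat.gcd n (m + 1)) := by
  rw [chebyshevT_resultant_derivative_T ℤ n m, mul_eq_zero, chebyshevTU_resultant_eq_zero_iff, or_iff_right]
  exact pow_ne_zero _ (by positivity)

end Summit.Ventures.HSemireg.Wedge.HankelOuter
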